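import Summits.AnomalousDissipation.AnomalousDissipation.Theorems.SolenoidalFractalHomogenisationLagrangianStepVmodCorrectedGeneratorPointwise
import HarnessLib

/-!
# K1L_D (stmt-AnomalousDissipation-27980), (ℓ3-A) road A, (S1c): the L² LAYER — from a pointwise bound
# `‖F x‖ ≤ a₀‖ζ x‖ + a₁Σ_c‖∂_cζ x‖ + a₂Σ_cΣ_e‖∂_e∂_cζ x‖` to `‖F‖_{L²} ≤ a₀‖ζ‖₂ + a₁Σ_c‖∂_cζ‖₂ + a₂Σ_cΣ_e‖∂_e∂_cζ‖₂`
(helper; `--supports 27980 --as helper`; prover ad-k1loc-p3 g11; RULING D28-18 (5): the `hN` of (D-GEN-J) p724081 is an L² bound; with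
(S1b) `norm_correctedGenerator_le_pt` this gives it in the LOSS CURRENCY of the test — `‖ζ₀‖₂, ‖∂ζ₀‖₂, ‖∂²ζ₀‖₂`, no sup norms of `ζ₀`.)

* `testMajorant ζ a₀ a₁ a₂` — the majorant `x ↦ a₀‖ζ x‖ + a₁Σ_c‖∂_cζ x‖ + a₂Σ_cΣ_e‖∂_e∂_cζ x‖`; `memLp_testMajorant`;
  `eLpNorm_testMajorant_le` (Minkowski: `≤ ofReal a₀·‖ζ‖₂ + ofReal a₁·Σ‖∂ζ‖₂ + ofReal a₂·ΣΣ‖∂²ζ‖₂` in `ℝ≥0∞`);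
* **`memLp_and_eLpNorm_le_of_pointwise`** — `F` a.e.-strongly measurable and `‖F x‖ ≤ testMajorant …(x)` ⇒ `MemLp F 2 ∧ eLpNorm F 2 ≤ ofReal (a₀‖ζ‖₂ +
  a₁Σ_c‖∂_cζ‖₂ + a₂Σ_cΣ_e‖∂_e∂_cζ‖₂)` (real form, the shape of `hN`);
* **`memLp_and_eLpNorm_correctedGenerator_le`** — (S1b)+(S1c): the generator on `J•ζ` at a fixed time, explicit `a₀,a₁,a₂`.
`sorry`-free; NOT a proof of any block, of K1L_D or of AD; rung F-D1.A0.
-/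

set_option linter.dupNamespace false

noncomputable section

namespace Summit.AnomalousDissipation.AnomalousDissipation.Theorems.SolenoidalFractalHomogenisation.LagrangianStep.VmodDist

open Literature.Analysis Literature.Analysis.FluidPDE Literature.Analysis.FunctionSpaces
open MeasureTheory Set
open scoped ENNReal

/-! ## §1 The test majorant and its L² norm -/

/-- The majorant `x ↦ a₀‖ζ x‖ + a₁Σ_c‖∂_cζ x‖ + a₂Σ_cΣ_e‖∂_e∂_cζ x‖`. -/
def testMajorant (ζ : VF) (a₀ a₁ a₂ : ℝ) (x : UnitAddTorus (Fin 3)) : ℝ :=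
  a₀ * ‖ζ x‖ + a₁ * ∑ c, ‖Torus.partialDeriv c ζ x‖ + a₂ * ∑ c, ∑ e, ‖Torus.partialDeriv e (Torus.partialDeriv c ζ) x‖

/-- Unfolding. -/
theorem testMajorant_apply (ζ : VF) (a₀ a₁ a₂ : ℝ) (x : UnitAddTorus (Fin 3)) :
    testMajorant ζ a₀ a₁ a₂ x
      = a₀ * ‖ζ x‖ + a₁ * ∑ c, ‖Torus.partialDeriv c ζ x‖ + a₂ * ∑ c, ∑ e, ‖Torus.partialDeriv e (Torus.partialDeriv c ζ) x‖ := rfl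

variable {ζ : VF}

/-- The three layers of the majorant are in `L²` (smooth test). -/
theorem memLp_norm_layers (hζ : Torus.IsSmooth ζ) :
    MemLp (fun x => ‖ζ x‖) 2 volume ∧ MemLp (fun x => ∑ c, ‖Torus.partialDeriv c ζ x‖) 2 volume ∧
      MemLp (fun x => ∑ c, ∑ e, ‖Torus.partialDeriv e (Torus.partialDeriv c ζ) x‖) 2 volume := by
  refine ⟨(hζ.memLp 2).norm, memLp_finsetSum _ fun c _ => ((hζ.partialDeriv c).memLp 2).norm,
    memLp_finsetSum _ fun c _ => memLp_finsetSum _ fun e _ => (((hζ.partialDeriv c).partialDeriv e).memLp 2).norm⟩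

/-- The majorant is in `L²`. -/
theorem memLp_testMajorant (hζ : Torus.IsSmooth ζ) (a₀ a₁ a₂ : ℝ) : MemLp (testMajorant ζ a₀ a₁ a₂) 2 volume := by
  obtain ⟨h0, h1, h2⟩ := memLp_norm_layers hζ
  have e : testMajorant ζ a₀ a₁ a₂ = fun x => a₀ * ‖ζ x‖ + a₁ * ∑ c, ‖Torus.partialDeriv c ζ x‖
      + a₂ * ∑ c, ∑ e, ‖Torus.partialDeriv e (Torus.partialDeriv c ζ) x‖ := rfl
  rw [e]
  exact ((h0.const_mul a₀).add (h1.const_mul a₁)).add (h2.const_mul a₂)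

/-- `‖x ↦ Σ_c‖∂_cζ x‖‖_{L²} ≤ Σ_c ‖∂_cζ‖_{L²}`. -/
theorem eLpNorm_sum_norm_partialDeriv_le (hζ : Torus.IsSmooth ζ) :
    eLpNorm (fun x => ∑ c, ‖Torus.partialDeriv c ζ x‖) 2 volume ≤ ∑ c, eLpNorm (Torus.partialDeriv c ζ) 2 volume := by
  have e : (fun x => ∑ c, ‖Torus.partialDeriv c ζ x‖) = ∑ c, fun x => ‖Torus.partialDeriv c ζ x‖ := by
    funext x; simp only [Finset.sum_apply]
  rw [e]
  refine (eLpNorm_sum_le (fun c _ => ((hζ.partialDeriv c).continuous.norm).aestronglyMeasurable) (by norm_num)).trans ?_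
  exact Finset.sum_le_sum fun c _ => (eLpNorm_norm (Torus.partialDeriv c ζ)).le

/-- `‖x ↦ Σ_cΣ_e‖∂_e∂_cζ x‖‖_{L²} ≤ Σ_cΣ_e ‖∂_e∂_cζ‖_{L²}`. -/
theorem eLpNorm_sum_norm_partialDeriv₂_le (hζ : Torus.IsSmooth ζ) :
    eLpNorm (fun x => ∑ c, ∑ e, ‖Torus.partialDeriv e (Torus.partialDeriv c ζ) x‖) 2 volume
      ≤ ∑ c, ∑ e, eLpNorm (Torus.partialDeriv e (Torus.partialDeriv c ζ)) 2 volume := by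
  have e : (fun x => ∑ c, ∑ e, ‖Torus.partialDeriv e (Torus.partialDeriv c ζ) x‖)
      = ∑ c, fun x => ∑ e, ‖Torus.partialDeriv e (Torus.partialDeriv c ζ) x‖ := by
    funext x; simp only [Finset.sum_apply]
  rw [e]
  have hm : ∀ c, AEStronglyMeasurable (fun x => ∑ e, ‖Torus.partialDeriv e (Torus.partialDeriv c ζ) x‖) volume := fun c =>
    (continuous_finsetSum _ fun e _ => ((hζ.partialDeriv c).partialDeriv e).continuous.norm).aestronglyMeasurable
  refine (eLpNorm_sum_le (fun c _ => hm c) (by norm_num)).trans (Finset.sum_le_sum fun c _ => ?_)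
  have e2 : (fun x => ∑ e, ‖Torus.partialDeriv e (Torus.partialDeriv c ζ) x‖)
      = ∑ e, fun x => ‖Torus.partialDeriv e (Torus.partialDeriv c ζ) x‖ := by
    funext x; simp only [Finset.sum_apply]
  rw [e2]
  refine (eLpNorm_sum_le (fun e _ => (((hζ.partialDeriv c).partialDeriv e).continuous.norm).aestronglyMeasurable) (by norm_num)).trans ?_
  exact Finset.sum_le_sum fun e _ => (eLpNorm_norm _).le

/-- `‖a·g‖_{L²} ≤ ofReal a · ‖g‖_{L²}` for `a ≥ 0` and real `g`. -/
theorem eLpNorm_const_mul_le_ofReal {g : UnitAddTorus (Fin 3) → ℝ} {a : ℝ} (ha : 0 ≤ a) :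
    eLpNorm (fun x => a * g x) 2 volume ≤ ENNReal.ofReal a * eLpNorm g 2 volume := by
  have e : (fun x => a * g x) = a • g := by funext x; simp [smul_eq_mul]
  rw [e, ← Real.enorm_of_nonneg ha]
  exact eLpNorm_const_smul_le

/-- **Minkowski for the majorant**: `‖testMajorant‖_{L²} ≤ ofReal a₀·‖ζ‖₂ + ofReal a₁·Σ_c‖∂_cζ‖₂ + ofReal a₂·Σ_cΣ_e‖∂_e∂_cζ‖₂`. -/
theorem eLpNorm_testMajorant_le (hζ : Torus.IsSmooth ζ) {a₀ a₁ a₂ : ℝ} (h0 : 0 ≤ a₀) (h1 : 0 ≤ a₁) (h2 : 0 ≤ a₂) :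
    eLpNorm (testMajorant ζ a₀ a₁ a₂) 2 volume
      ≤ ENNReal.ofReal a₀ * eLpNorm ζ 2 volume + ENNReal.ofReal a₁ * ∑ c, eLpNorm (Torus.partialDeriv c ζ) 2 volume
        + ENNReal.ofReal a₂ * ∑ c, ∑ e, eLpNorm (Torus.partialDeriv e (Torus.partialDeriv c ζ)) 2 volume := by
  obtain ⟨m0, m1, m2⟩ := memLp_norm_layers hζ
  have e : testMajorant ζ a₀ a₁ a₂ = (fun x => a₀ * ‖ζ x‖ + a₁ * ∑ c, ‖Torus.partialDeriv c ζ x‖)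
      + fun x => a₂ * ∑ c, ∑ e, ‖Torus.partialDeriv e (Torus.partialDeriv c ζ) x‖ := by
    funext x; rfl
  have hA : AEStronglyMeasurable (fun x => a₀ * ‖ζ x‖) volume := (m0.const_mul a₀).aestronglyMeasurable
  have hB : AEStronglyMeasurable (fun x => a₁ * ∑ c, ‖Torus.partialDeriv c ζ x‖) volume := (m1.const_mul a₁).aestronglyMeasurable
  have hC : AEStronglyMeasurable (fun x => a₂ * ∑ c, ∑ e, ‖Torus.partialDeriv e (Torus.partialDeriv c ζ) x‖) volume :=
    (m2.const_mul a₂).aestronglyMeasurable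
  rw [e]
  refine (eLpNorm_add_le (hA.add hB) hC (by norm_num)).trans ?_
  refine (add_le_add (eLpNorm_add_le hA hB (by norm_num)) le_rfl).trans ?_
  refine add_le_add (add_le_add ?_ ?_) ?_
  · refine (eLpNorm_const_mul_le_ofReal h0).trans (le_of_eq ?_)
    rw [eLpNorm_norm]
  · exact (eLpNorm_const_mul_le_ofReal h1).trans (mul_le_mul_of_nonneg_left (eLpNorm_sum_norm_partialDeriv_le hζ) bot_le)
  · exact (eLpNorm_const_mul_le_ofReal h2).trans (mul_le_mul_of_nonneg_left (eLpNorm_sum_norm_partialDeriv₂_le hζ) bot_le)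

/-! ## §2 From pointwise to L² -/

/-- **(S1c)**: an a.e.-strongly measurable field dominated pointwise by the test majorant is in `L²` with
`‖F‖_{L²} ≤ ofReal (a₀‖ζ‖₂ + a₁Σ_c‖∂_cζ‖₂ + a₂Σ_cΣ_e‖∂_e∂_cζ‖₂)` (the real form of `hN`). -/
theorem memLp_and_eLpNorm_le_of_pointwise {E : Type*} [NormedAddCommGroup E] {F : UnitAddTorus (Fin 3) → E}
    (hF : AEStronglyMeasurable F volume) (hζ : Torus.IsSmooth ζ) {a₀ a₁ a₂ : ℝ} (h0 : 0 ≤ a₀) (h1 : 0 ≤ a₁) (h2 : 0 ≤ a₂)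
    (hpt : ∀ x, ‖F x‖ ≤ testMajorant ζ a₀ a₁ a₂ x) :
    MemLp F 2 volume ∧
      eLpNorm F 2 volume ≤ ENNReal.ofReal (a₀ * (eLpNorm ζ 2 volume).toReal
        + a₁ * ∑ c, (eLpNorm (Torus.partialDeriv c ζ) 2 volume).toReal
        + a₂ * ∑ c, ∑ e, (eLpNorm (Torus.partialDeriv e (Torus.partialDeriv c ζ)) 2 volume).toReal) := by
  have hM := memLp_testMajorant hζ a₀ a₁ a₂
  have hnn : ∀ x, 0 ≤ testMajorant ζ a₀ a₁ a₂ x := fun x => (norm_nonneg _).trans (hpt x)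
  have hdom : ∀ x, ‖F x‖ ≤ ‖testMajorant ζ a₀ a₁ a₂ x‖ := fun x => by
    rw [Real.norm_of_nonneg (hnn x)]; exact hpt x
  refine ⟨hM.of_le hF (Filter.Eventually.of_forall hdom), ?_⟩
  refine ((eLpNorm_mono_real hpt).trans (eLpNorm_testMajorant_le hζ h0 h1 h2)).trans (le_of_eq ?_)
  -- finiteness of the three norms
  have f0 : eLpNorm ζ 2 volume ≠ ⊤ := (hζ.memLp 2).eLpNorm_ne_top
  have f1 : ∀ c, eLpNorm (Torus.partialDeriv c ζ) 2 volume ≠ ⊤ := fun c => ((hζ.partialDeriv c).memLp 2).eLpNorm_ne_top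
  have f2 : ∀ c e, eLpNorm (Torus.partialDeriv e (Torus.partialDeriv c ζ)) 2 volume ≠ ⊤ := fun c e =>
    (((hζ.partialDeriv c).partialDeriv e).memLp 2).eLpNorm_ne_top
  have s1 : ∑ c, eLpNorm (Torus.partialDeriv c ζ) 2 volume = ENNReal.ofReal (∑ c, (eLpNorm (Torus.partialDeriv c ζ) 2 volume).toReal) := by
    rw [ENNReal.ofReal_sum_of_nonneg fun c _ => ENNReal.toReal_nonneg]
    exact Finset.sum_congr rfl fun c _ => (ENNReal.ofReal_toReal (f1 c)).symm
  have s2 : ∑ c, ∑ e, eLpNorm (Torus.partialDeriv e (Torus.partialDeriv c ζ)) 2 volume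
      = ENNReal.ofReal (∑ c, ∑ e, (eLpNorm (Torus.partialDeriv e (Torus.partialDeriv c ζ)) 2 volume).toReal) := by
    rw [ENNReal.ofReal_sum_of_nonneg fun c _ => Finset.sum_nonneg fun e _ => ENNReal.toReal_nonneg]
    refine Finset.sum_congr rfl fun c _ => ?_
    rw [ENNReal.ofReal_sum_of_nonneg fun e _ => ENNReal.toReal_nonneg]
    exact Finset.sum_congr rfl fun e _ => (ENNReal.ofReal_toReal (f2 c e)).symm
  have hS1 : 0 ≤ ∑ c, (eLpNorm (Torus.partialDeriv c ζ) 2 volume).toReal := Finset.sum_nonneg fun c _ => ENNReal.toReal_nonneg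
  have hS2 : 0 ≤ ∑ c, ∑ e, (eLpNorm (Torus.partialDeriv e (Torus.partialDeriv c ζ)) 2 volume).toReal :=
    Finset.sum_nonneg fun c _ => Finset.sum_nonneg fun e _ => ENNReal.toReal_nonneg
  rw [s1, s2, ← ENNReal.ofReal_toReal f0, ← ENNReal.ofReal_mul h0, ← ENNReal.ofReal_mul h1, ← ENNReal.ofReal_mul h2,
    ← ENNReal.ofReal_add (mul_nonneg h0 ENNReal.toReal_nonneg) (mul_nonneg h1 hS1),
    ← ENNReal.ofReal_add (add_nonneg (mul_nonneg h0 ENNReal.toReal_nonneg) (mul_nonneg h1 hS1)) (mul_nonneg h2 hS2),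
    ENNReal.toReal_ofReal ENNReal.toReal_nonneg]

/-! ## §3 The corrected generator at a fixed time -/

variable {Gs Jt J't : UnitAddTorus (Fin 3) → Matrix (Fin 3) (Fin 3) ℝ} {b₀ : VF}

/-- **(S1b)+(S1c): the L² bound of the distorted generator on the corrected steady test `J•ζ` at a fixed time**, for a
CONTINUOUS carrier slice `b₀` (measurability), in the test's L²-currency with the explicit `a₀,a₁,a₂` of `norm_correctedGenerator_le_pt`. -/
theorem memLp_and_eLpNorm_correctedGenerator_le
    (hG1 : ∀ i j, Torus.IsContDiff 1 (fun y => Gs y i j)) (hJ : ∀ a m, Torus.IsSmooth (fun y => Jt y a m)) (hζ : Torus.IsSmooth ζ)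
    (𝔸' : Torus.Visc4 (Fin 3)) (hF : AEStronglyMeasurable (fun x => Torus.distort J't ζ x + Torus.convect b₀ (Torus.distort Jt ζ) x
        + Torus.viscAdjVar (fun y => Torus.Visc4.conj (Gs y) 𝔸') (Torus.distort Jt ζ) x) volume)
    {C B A C₀ C₁ C₂ CJ' Bb : ℝ} (hC0' : 0 ≤ C) (hB0 : 0 ≤ B) (hA0 : 0 ≤ A) (hC0 : 0 ≤ C₀) (hC1 : 0 ≤ C₁)
    (hC2 : 0 ≤ C₂) (hCJ'0 : 0 ≤ CJ') (hBb0 : 0 ≤ Bb)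
    (hC : ∀ y i j, |Gs y i j| ≤ C) (hB : ∀ y i j e', |Torus.partialDeriv e' (fun y => Gs y i j) y| ≤ B) (hA : ∀ i a j b', |𝔸' i a j b'| ≤ A)
    (hJ0 : ∀ y a m, |Jt y a m| ≤ C₀) (hJ1 : ∀ y a m c, |Torus.partialDeriv c (fun y => Jt y a m) y| ≤ C₁)
    (hJ2 : ∀ y a m c e, |Torus.partialDeriv e (Torus.partialDeriv c (fun y => Jt y a m)) y| ≤ C₂)
    (hJ' : ∀ y a m, |J't y a m| ≤ CJ') (hb : ∀ y, ‖b₀ y‖ ≤ Bb) :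
    MemLp (fun x => Torus.distort J't ζ x + Torus.convect b₀ (Torus.distort Jt ζ) x
        + Torus.viscAdjVar (fun y => Torus.Visc4.conj (Gs y) 𝔸') (Torus.distort Jt ζ) x) 2 volume ∧
      eLpNorm (fun x => Torus.distort J't ζ x + Torus.convect b₀ (Torus.distort Jt ζ) x
          + Torus.viscAdjVar (fun y => Torus.Visc4.conj (Gs y) 𝔸') (Torus.distort Jt ζ) x) 2 volume
        ≤ ENNReal.ofReal
          ((9 * CJ' + 27 * Bb * C₁ + 3 * (27 * (C * A * C) * (81 * C₂) + 81 * (C * A * B + B * A * C) * (27 * C₁))) * (eLpNorm ζ 2 volume).toReal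
          + (9 * Bb * C₀ + 3 * (27 * (C * A * C) * (54 * C₁) + 81 * (C * A * B + B * A * C) * (9 * C₀)))
              * ∑ c, (eLpNorm (Torus.partialDeriv c ζ) 2 volume).toReal
          + (3 * (27 * (C * A * C) * (9 * C₀))) * ∑ c, ∑ e, (eLpNorm (Torus.partialDeriv e (Torus.partialDeriv c ζ)) 2 volume).toReal) := by
  refine memLp_and_eLpNorm_le_of_pointwise hF hζ (by positivity) (by positivity) (by positivity) fun x => ?_
  rw [testMajorant_apply]
  exact norm_correctedGenerator_le_pt hG1 hJ hζ 𝔸' hC0' hB0 hA0 hC0 hC1 hC2 hCJ'0 hBb0 hC hB hA hJ0 hJ1 hJ2 hJ' hb x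

end Summit.AnomalousDissipation.AnomalousDissipation.Theorems.SolenoidalFractalHomogenisation.LagrangianStep.VmodDist

end
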